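import Summits.QuantumFields.YangMills.Theorems.BalabanUVNodesN21ShellSplitOfRecord13CoPHChartKeyed
import Summits.QuantumFields.YangMills.Theorems.BalabanUVNodesN21StepWeightsPositivity
import Literature.MathematicalPhysics.QuantumFieldTheory.Balaban1983to89.Node00.Record12MeasurabilityAbsolute

/-!
# N21 (NE7c) · THE CHART-ROAD FACE IN LEAF D's `h21` BINDER SHAPE: `ShellWeightBound` at `crOfRecord₁₃VAt K₀ (jc F θ hP g₀ os) (shellSplitOfRecord₁₃At N K₀ ρA ρB)`
# for EVERY guarded admissible Stage-13 tuple, the cut policy `jc` READ PER TUPLE (K3⁷ v4∕v5 `CutReading` ∕ `PinnedAtLive`), from per-tuple ∃-packages of chart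
# data — with (H-U) DISCHARGED (`Node00.localBgMeasurable`, K0c) and `0 ≤ ζ` DISCHARGED from the provisos (`N21StepWeightsPositivity.zetaOfRecord_nonneg`)

Track A of `YM-PLAN.md` (cell `pub-ymgap`, HUMAN RULING D-0062 ∕ D-0149 width seats), node **N21**; WIDTH SEAT `pub-ymgap-dag-n21-w2` (gen 2), file 14.
THEOREMS ONLY: 0 `def`, 0 `sorry`; COUNT-NEUTRAL; `--kind proof --supports stmt-QuantumFields-20544 --as helper`.  Imports my socket `…ChartKeyed` (p605800 ★★
`shellWeightBound_crOfRecord₁₃VAt_shellSplit_of_chartLaws`), dag-n21-d's `…N21StepWeightsPositivity` (`zetaOfRecord_nonneg`) and K0c's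
`Node00/Record12MeasurabilityAbsolute` (`localBgMeasurable` — (H-U) IS A THEOREM).  NO Theses import.  Restates nothing; cites by name.

WHY.  K3⁷ v4∕v5 stub 2 asks `∃ (jc : CutReading) (sh : ShellSplit₁₃CoPH 2 0) (cr : SpineReading), PinnedAtLive jc sh cr ∧ … ∧ KeyedShellWeight cr ∧ …` with
`KeyedShellWeight cr := ∀ F θ hP, (θ.ZhUnity F 2 ∧ θ.SlotsNondegenerate₁₃ F 2) → θ.Admissible F 2 → ∀ g₀ os, ShellWeightBound (cr F θ hP g₀ os).l₀ … (cr F θ hP g₀ os).Wsh`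
(leaf D's `h21`; dag-n27-c's guarded composites key it on a regime `Rg`).  My gen-0 file typed the DILATION road in exactly this shape
(`…N21DilationRoadAtRecord13CoPH.shellWeightBound_guarded₁₃CoPH_of_dilationLevels`, ref-O READ-79: «checked VERBATIM against leaf D's `h21`»); this file does the same for
the CHART road of p605800: the per-tuple hypotheses are an ∃-package `(E, DA, DB)` of n20-d's selector row `hsel`, (H-ζ), the widths' signs, `0 ≤ D_K`, `Σ D_K ρ_K < ∞`,
and the two per-fibre chart-data families; (H-U) and `0 ≤ ζ` are no longer asked.

WHAT IS PROVED ([bookkeeping]; one `obtain` + one application of p605800 per tuple).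
* ★★ `shellWeightBound_guarded₁₃CoPH_of_chartLaws` — for `Rg`-guarded admissible tuples, `ShellWeightBound` at `crOfRecord₁₃VAt K₀ (jc F θ hP g₀ os) (shellSplitOfRecord₁₃At N K₀ ρA ρB)`.
* ★ `shellWeightBound_guarded₁₃CoPH_crOfRecord₁₃V_of_chartLaws` — the `K₀ = 0` edition AT THE PIN `crOfRecord₁₃V (jc F θ hP g₀ os) (shellSplitOfRecord₁₃At N 0 ρA ρB)`
  (n20-d `crOfRecord₁₃V_eq`, `rfl`) — the literal `KeyedShellWeight`-conjunct shape of a `PinnedAtLive` witness on the guard `Rg`.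
* `s_N21_sRec₁₃CoPHOn_chartRoad` — the regime home `S_N21 (SRec₁₃CoPHOn cr Rg)` at `cr := fun F θ hP g₀ os => crOfRecord₁₃VAt K₀ (jc F θ hP g₀ os) … F θ hP g₀ os`
  (dag-n19-d `s_N21_sRec₁₃CoPHOn_iff` BY NAME).

HONEST FRAMING.  The per-fibre chart data (window factorisation, density presentation, reading identity, cut-chart-law (M1)), `hsel`, (H-ζ), widths and `D_K` remain
HYPOTHESES (located letters; inhabited for no family here); (H-U) and `0 ≤ ζ` are the tree's theorems; `jc` is the consumer's dial; K0⁷ OPEN (no tuple with provisos claimed —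
per-tuple hypotheses are VACUOUS without one: A1 standing line); nothing of Bałaban's asserted; NE7c NOT PRINTED ∕ NOT proved; **N21 NOT discharged**; K3⁷ NOT claimed; counts
UNMOVED (typed 28∕28 · discharged 5∕27); one finite four-torus programme at fixed `ε` — NOT ℝ⁴, NOT infinite volume, NOT OS, NOT a mass gap, NOT Clay.  No cite tags.
-/

set_option autoImplicit false

open scoped BigOperators ENNReal
open Finset MeasureTheory Function Metric

namespace Summit.QuantumFields.YangMills.Theorems.N21ChartJunctionKeyed

open Literature.MathematicalPhysics.QuantumFieldTheory.Balaban1983to89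
open Literature.MathematicalPhysics.QuantumFieldTheory.Balaban1983to89.T4Continuum
open Literature.MathematicalPhysics.QuantumFieldTheory.Balaban1983to89.Node00 hiding dimSU
open T4ShellMeasure (SlotAntiConcentration)
open T4ShellMeasureDet (blockLaw)
open T4IndicatorShell (ShellWeightBound)
open YMDAG.UVSplit (crOfRecord₁₃At crOfRecord₁₃VAt crOfRecord₁₃V crOfRecord₁₃V_eq ShellSplit₁₃CoPH SpineReading₁₃CoPH SRec₁₃CoPHOn S_N21
  runA₁₃ runB₁₃ histA₁₃ histB₁₃)
open N21ShellSplitOfRecord13CoPH (WidthLetter₁₃CoPH shellSplitOfRecord₁₃At cubeStat inputBlock blockReading blockFibreLawOfDatum₉)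
open N21StepWeightsPositivity (zetaOfRecord_nonneg)
open Summit.QuantumFields.YangMills.BalabanUVNodes.N19TargetAtHomes13CoPHOn (s_N21_sRec₁₃CoPHOn_iff)
open Summit.QuantumFields.BalabanUV.T4Continuum.ShellMeasureExpChartSUN (SUN BlockChartSU expFibreChartSU chartWeightSU)
open Summit.QuantumFields.BalabanUV.T4Continuum.ShellMeasureScalingSUN (windowSU)
open Summit.QuantumFields.BalabanUV.T4Continuum.ShellMeasureExpJacobianSUN (expJacWeightSU)
open Summit.QuantumFields.BalabanUV.T4Continuum.ShellMeasureExpHaarAreaSUN (kappaSU)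

section Guarded

variable {N : ℕ} [NeZero N] (K₀ : ℕ)
  (jc : (F : T4Family) → (θ : Stage13HParams F N) → θ.Provisos₁₃CoPH F N → (ℕ → ℝ) → List (ULoop F) → ℕ → ℕ)
  (ρA ρB : WidthLetter₁₃CoPH N) (Rg : (F : T4Family) → Stage13HParams F N → Prop)

/-- ★★ **THE CHART-ROAD FACE, GUARDED, CUT READ PER TUPLE.**  For every `Rg`-guarded admissible Stage-13 tuple with core provisos, `ShellWeightBound` at
`crOfRecord₁₃VAt K₀ (jc F θ hP g₀ os) (shellSplitOfRecord₁₃At N K₀ ρA ρB) F θ hP g₀ os` (carriers + canonical `Wsh`) from a per-tuple ∃-package `(E, DA, DB)`: n20-d's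
selector row `hsel`, (H-ζ), the widths' signs, `0 ≤ D_K`, `Σ_K D_K ρ_K < ∞` for both runs, and the two per-fibre families of chart-data packages of p605800 §2;
(H-U) := `Node00.localBgMeasurable F N θ.ν`, `0 ≤ ζ` := `zetaOfRecord_nonneg … hP.zetaUnity hP.zetaAbs`.  Leaf D's `h21` binder shape at this reading
(`Rg := fun F θ => θ.ZhUnity F 2 ∧ θ.SlotsNondegenerate₁₃ F 2`, `N = 2`; or `Rg ∧ LiveSel` for the live∕off-live split). [bookkeeping] -/
theorem shellWeightBound_guarded₁₃CoPH_of_chartLaws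
    (hread : ∀ (F : T4Family) (θ : Stage13HParams F N) (hP : θ.Provisos₁₃CoPH F N), Rg F θ → θ.Admissible F N →
      ∀ (g₀ : ℕ → ℝ) (os : List (ULoop F)),
      ∃ (E : B12.RunParams → ℝ) (DA DB : ℕ → ℝ),
        θ.ppSel = ppSelLiveOfRecord F N θ.ν θ.τ9 E (wOfRecord₉ F N θ.toStage9Params) ∧ ZetaMeasurable F N θ.ζ ∧
        (∀ K, 0 ≤ ρA F θ hP g₀ os K) ∧ (∀ K, 0 ≤ DA K) ∧ (∀ K, 0 ≤ ρB F θ hP g₀ os K) ∧ (∀ K, 0 ≤ DB K) ∧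
        Summable (fun K => DA K * ρA F θ hP g₀ os K) ∧ Summable (fun K => DB K * ρB F θ hP g₀ os K) ∧
        (∀ (K : ℕ) (t : ℝ), |t| ≤ 1 →
          ∀ (a : ↥(cubeIndices (F.P (K₀ + K)) (cubeSide (F.P (K₀ + K)).L θ.ν.M₂ (RkOfRecord (F.P (K₀ + K)).L θ.ν.r (histA₁₃ θ K₀ g₀ K (K₀ + K))) (K₀ + K))))
            (x : GaugeField (F.P (K₀ + K)) (K₀ + K) (SU N)),
            ∃ (S : ℝ) (c : GaugeField (F.P (K₀ + K)) (K₀ + K) (SU N)) (R : (↥(inputBlock F θ.ν (histA₁₃ θ K₀ g₀ K) a) → SU N) → ℝ≥0∞)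
              (U : BlockChartSU N (inputBlock F θ.ν (histA₁₃ θ K₀ g₀ K) a) → ℝ) (A : Set (BlockChartSU N (inputBlock F θ.ν (histA₁₃ θ K₀ g₀ K) a)))
              (f : BlockChartSU N (inputBlock F θ.ν (histA₁₃ θ K₀ g₀ K) a) → ℝ≥0∞) (D : ℝ),
              0 ≤ S ∧ S ≤ Real.pi ∧ Measurable R ∧
              blockFibreLawOfDatum₉ F N θ.toStage9Params (datumOfRecord₁₃CoPH F N θ hP) g₀ os (runA₁₃ F K₀ g₀ K) (histA₁₃ θ K₀ g₀ K) (K₀ + K) t a (inputBlock F θ.ν (histA₁₃ θ K₀ g₀ K) a) x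
                = (blockLaw (inputBlock F θ.ν (histA₁₃ θ K₀ g₀ K) a)).withDensity (fun y => windowSU (inputBlock F θ.ν (histA₁₃ θ K₀ g₀ K) a) c S y * R y) ∧
              MeasurableSet A ∧
              (∀ z ∈ closedBall (0 : BlockChartSU N (inputBlock F θ.ν (histA₁₃ θ K₀ g₀ K) a)) S,
                blockReading N (cubeStat F N θ.ν (histA₁₃ θ K₀ g₀ K) (Kc := K₀ + K) (k := K₀ + K) a) (inputBlock F θ.ν (histA₁₃ θ K₀ g₀ K) a) (fun _ => 1) (expFibreChartSU (inputBlock F θ.ν (histA₁₃ θ K₀ g₀ K) a) c z) = U z) ∧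
              ((fun z : BlockChartSU N (inputBlock F θ.ν (histA₁₃ θ K₀ g₀ K) a) =>
                  chartWeightSU (inputBlock F θ.ν (histA₁₃ θ K₀ g₀ K) a) S (expJacWeightSU (kappaSU N)) z * R (expFibreChartSU (inputBlock F θ.ν (histA₁₃ θ K₀ g₀ K) a) c z))
                =ᵐ[volume] A.indicator f) ∧
              SlotAntiConcentration (((volume : Measure (BlockChartSU N (inputBlock F θ.ν (histA₁₃ θ K₀ g₀ K) a))).withDensity f).restrict A) U
                (epsOfRecord θ.ν (histA₁₃ θ K₀ g₀ K) (K₀ + K)) (ρA F θ hP g₀ os K) D ∧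
              D ≤ DA K) ∧
        (∀ (K : ℕ) (t : ℝ), |t| ≤ 1 →
          ∀ (a : ↥(cubeIndices (F.P (K₀ + K + 1)) (cubeSide (F.P (K₀ + K + 1)).L θ.ν.M₂ (RkOfRecord (F.P (K₀ + K + 1)).L θ.ν.r (histB₁₃ θ K₀ g₀ K (K₀ + K + 1))) (K₀ + K + 1))))
            (x : GaugeField (F.P (K₀ + K + 1)) (K₀ + K + 1) (SU N)),
            ∃ (S : ℝ) (c : GaugeField (F.P (K₀ + K + 1)) (K₀ + K + 1) (SU N)) (R : (↥(inputBlock F θ.ν (histB₁₃ θ K₀ g₀ K) a) → SU N) → ℝ≥0∞)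
              (U : BlockChartSU N (inputBlock F θ.ν (histB₁₃ θ K₀ g₀ K) a) → ℝ) (A : Set (BlockChartSU N (inputBlock F θ.ν (histB₁₃ θ K₀ g₀ K) a)))
              (f : BlockChartSU N (inputBlock F θ.ν (histB₁₃ θ K₀ g₀ K) a) → ℝ≥0∞) (D : ℝ),
              0 ≤ S ∧ S ≤ Real.pi ∧ Measurable R ∧
              blockFibreLawOfDatum₉ F N θ.toStage9Params (datumOfRecord₁₃CoPH F N θ hP) g₀ os (runB₁₃ F K₀ g₀ K) (histB₁₃ θ K₀ g₀ K) (K₀ + K + 1) t a (inputBlock F θ.ν (histB₁₃ θ K₀ g₀ K) a) x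
                = (blockLaw (inputBlock F θ.ν (histB₁₃ θ K₀ g₀ K) a)).withDensity (fun y => windowSU (inputBlock F θ.ν (histB₁₃ θ K₀ g₀ K) a) c S y * R y) ∧
              MeasurableSet A ∧
              (∀ z ∈ closedBall (0 : BlockChartSU N (inputBlock F θ.ν (histB₁₃ θ K₀ g₀ K) a)) S,
                blockReading N (cubeStat F N θ.ν (histB₁₃ θ K₀ g₀ K) (Kc := K₀ + K + 1) (k := K₀ + K + 1) a) (inputBlock F θ.ν (histB₁₃ θ K₀ g₀ K) a) (fun _ => 1) (expFibreChartSU (inputBlock F θ.ν (histB₁₃ θ K₀ g₀ K) a) c z) = U z) ∧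
              ((fun z : BlockChartSU N (inputBlock F θ.ν (histB₁₃ θ K₀ g₀ K) a) =>
                  chartWeightSU (inputBlock F θ.ν (histB₁₃ θ K₀ g₀ K) a) S (expJacWeightSU (kappaSU N)) z * R (expFibreChartSU (inputBlock F θ.ν (histB₁₃ θ K₀ g₀ K) a) c z))
                =ᵐ[volume] A.indicator f) ∧
              SlotAntiConcentration (((volume : Measure (BlockChartSU N (inputBlock F θ.ν (histB₁₃ θ K₀ g₀ K) a))).withDensity f).restrict A) U
                (epsOfRecord θ.ν (histB₁₃ θ K₀ g₀ K) (K₀ + K + 1)) (ρB F θ hP g₀ os K) D ∧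
              D ≤ DB K))
    (F : T4Family) (θ : Stage13HParams F N) (hP : θ.Provisos₁₃CoPH F N) (hRg : Rg F θ) (hθ : θ.Admissible F N)
    (g₀ : ℕ → ℝ) (os : List (ULoop F)) :
    letI S := crOfRecord₁₃VAt K₀ (jc F θ hP g₀ os) (shellSplitOfRecord₁₃At N K₀ ρA ρB) F θ hP g₀ os
    ShellWeightBound S.l₀ S.T S.A S.B S.shA S.shB S.Wsh := by
  obtain ⟨E, DA, DB, hsel, hζm, hρA, hDA, hρB, hDB, hsA, hsB, hA, hB⟩ := hread F θ hP hRg hθ g₀ os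
  exact shellWeightBound_crOfRecord₁₃VAt_shellSplit_of_chartLaws K₀ (jc F θ hP g₀ os) ρA ρB θ hP g₀ os E hsel (localBgMeasurable F N θ.ν) hζm
    (zetaOfRecord_nonneg F N θ.ν θ.τ9.M hP.zetaUnity hP.zetaAbs) hρA hDA hρB hDB hsA hsB hA hB

/-- **REGIME HOME**: the same per-tuple packages give `S_N21 (SRec₁₃CoPHOn cr Rg)` at the chart-road reading `cr := fun F θ hP g₀ os =>
crOfRecord₁₃VAt K₀ (jc F θ hP g₀ os) (shellSplitOfRecord₁₃At N K₀ ρA ρB) F θ hP g₀ os` (dag-n19-d `s_N21_sRec₁₃CoPHOn_iff` BY NAME).  NOT a discharge. [bookkeeping] -/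
theorem s_N21_sRec₁₃CoPHOn_chartRoad
    (hread : ∀ (F : T4Family) (θ : Stage13HParams F N) (hP : θ.Provisos₁₃CoPH F N), Rg F θ → θ.Admissible F N →
      ∀ (g₀ : ℕ → ℝ) (os : List (ULoop F)),
      ∃ (E : B12.RunParams → ℝ) (DA DB : ℕ → ℝ),
        θ.ppSel = ppSelLiveOfRecord F N θ.ν θ.τ9 E (wOfRecord₉ F N θ.toStage9Params) ∧ ZetaMeasurable F N θ.ζ ∧
        (∀ K, 0 ≤ ρA F θ hP g₀ os K) ∧ (∀ K, 0 ≤ DA K) ∧ (∀ K, 0 ≤ ρB F θ hP g₀ os K) ∧ (∀ K, 0 ≤ DB K) ∧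
        Summable (fun K => DA K * ρA F θ hP g₀ os K) ∧ Summable (fun K => DB K * ρB F θ hP g₀ os K) ∧
        (∀ (K : ℕ) (t : ℝ), |t| ≤ 1 →
          ∀ (a : ↥(cubeIndices (F.P (K₀ + K)) (cubeSide (F.P (K₀ + K)).L θ.ν.M₂ (RkOfRecord (F.P (K₀ + K)).L θ.ν.r (histA₁₃ θ K₀ g₀ K (K₀ + K))) (K₀ + K))))
            (x : GaugeField (F.P (K₀ + K)) (K₀ + K) (SU N)),
            ∃ (S : ℝ) (c : GaugeField (F.P (K₀ + K)) (K₀ + K) (SU N)) (R : (↥(inputBlock F θ.ν (histA₁₃ θ K₀ g₀ K) a) → SU N) → ℝ≥0∞)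
              (U : BlockChartSU N (inputBlock F θ.ν (histA₁₃ θ K₀ g₀ K) a) → ℝ) (A : Set (BlockChartSU N (inputBlock F θ.ν (histA₁₃ θ K₀ g₀ K) a)))
              (f : BlockChartSU N (inputBlock F θ.ν (histA₁₃ θ K₀ g₀ K) a) → ℝ≥0∞) (D : ℝ),
              0 ≤ S ∧ S ≤ Real.pi ∧ Measurable R ∧
              blockFibreLawOfDatum₉ F N θ.toStage9Params (datumOfRecord₁₃CoPH F N θ hP) g₀ os (runA₁₃ F K₀ g₀ K) (histA₁₃ θ K₀ g₀ K) (K₀ + K) t a (inputBlock F θ.ν (histA₁₃ θ K₀ g₀ K) a) x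
                = (blockLaw (inputBlock F θ.ν (histA₁₃ θ K₀ g₀ K) a)).withDensity (fun y => windowSU (inputBlock F θ.ν (histA₁₃ θ K₀ g₀ K) a) c S y * R y) ∧
              MeasurableSet A ∧
              (∀ z ∈ closedBall (0 : BlockChartSU N (inputBlock F θ.ν (histA₁₃ θ K₀ g₀ K) a)) S,
                blockReading N (cubeStat F N θ.ν (histA₁₃ θ K₀ g₀ K) (Kc := K₀ + K) (k := K₀ + K) a) (inputBlock F θ.ν (histA₁₃ θ K₀ g₀ K) a) (fun _ => 1) (expFibreChartSU (inputBlock F θ.ν (histA₁₃ θ K₀ g₀ K) a) c z) = U z) ∧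
              ((fun z : BlockChartSU N (inputBlock F θ.ν (histA₁₃ θ K₀ g₀ K) a) =>
                  chartWeightSU (inputBlock F θ.ν (histA₁₃ θ K₀ g₀ K) a) S (expJacWeightSU (kappaSU N)) z * R (expFibreChartSU (inputBlock F θ.ν (histA₁₃ θ K₀ g₀ K) a) c z))
                =ᵐ[volume] A.indicator f) ∧
              SlotAntiConcentration (((volume : Measure (BlockChartSU N (inputBlock F θ.ν (histA₁₃ θ K₀ g₀ K) a))).withDensity f).restrict A) U
                (epsOfRecord θ.ν (histA₁₃ θ K₀ g₀ K) (K₀ + K)) (ρA F θ hP g₀ os K) D ∧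
              D ≤ DA K) ∧
        (∀ (K : ℕ) (t : ℝ), |t| ≤ 1 →
          ∀ (a : ↥(cubeIndices (F.P (K₀ + K + 1)) (cubeSide (F.P (K₀ + K + 1)).L θ.ν.M₂ (RkOfRecord (F.P (K₀ + K + 1)).L θ.ν.r (histB₁₃ θ K₀ g₀ K (K₀ + K + 1))) (K₀ + K + 1))))
            (x : GaugeField (F.P (K₀ + K + 1)) (K₀ + K + 1) (SU N)),
            ∃ (S : ℝ) (c : GaugeField (F.P (K₀ + K + 1)) (K₀ + K + 1) (SU N)) (R : (↥(inputBlock F θ.ν (histB₁₃ θ K₀ g₀ K) a) → SU N) → ℝ≥0∞)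
              (U : BlockChartSU N (inputBlock F θ.ν (histB₁₃ θ K₀ g₀ K) a) → ℝ) (A : Set (BlockChartSU N (inputBlock F θ.ν (histB₁₃ θ K₀ g₀ K) a)))
              (f : BlockChartSU N (inputBlock F θ.ν (histB₁₃ θ K₀ g₀ K) a) → ℝ≥0∞) (D : ℝ),
              0 ≤ S ∧ S ≤ Real.pi ∧ Measurable R ∧
              blockFibreLawOfDatum₉ F N θ.toStage9Params (datumOfRecord₁₃CoPH F N θ hP) g₀ os (runB₁₃ F K₀ g₀ K) (histB₁₃ θ K₀ g₀ K) (K₀ + K + 1) t a (inputBlock F θ.ν (histB₁₃ θ K₀ g₀ K) a) x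
                = (blockLaw (inputBlock F θ.ν (histB₁₃ θ K₀ g₀ K) a)).withDensity (fun y => windowSU (inputBlock F θ.ν (histB₁₃ θ K₀ g₀ K) a) c S y * R y) ∧
              MeasurableSet A ∧
              (∀ z ∈ closedBall (0 : BlockChartSU N (inputBlock F θ.ν (histB₁₃ θ K₀ g₀ K) a)) S,
                blockReading N (cubeStat F N θ.ν (histB₁₃ θ K₀ g₀ K) (Kc := K₀ + K + 1) (k := K₀ + K + 1) a) (inputBlock F θ.ν (histB₁₃ θ K₀ g₀ K) a) (fun _ => 1) (expFibreChartSU (inputBlock F θ.ν (histB₁₃ θ K₀ g₀ K) a) c z) = U z) ∧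
              ((fun z : BlockChartSU N (inputBlock F θ.ν (histB₁₃ θ K₀ g₀ K) a) =>
                  chartWeightSU (inputBlock F θ.ν (histB₁₃ θ K₀ g₀ K) a) S (expJacWeightSU (kappaSU N)) z * R (expFibreChartSU (inputBlock F θ.ν (histB₁₃ θ K₀ g₀ K) a) c z))
                =ᵐ[volume] A.indicator f) ∧
              SlotAntiConcentration (((volume : Measure (BlockChartSU N (inputBlock F θ.ν (histB₁₃ θ K₀ g₀ K) a))).withDensity f).restrict A) U
                (epsOfRecord θ.ν (histB₁₃ θ K₀ g₀ K) (K₀ + K + 1)) (ρB F θ hP g₀ os K) D ∧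
              D ≤ DB K))
    :
    S_N21 (SRec₁₃CoPHOn (fun F θ hP g₀ os => crOfRecord₁₃VAt K₀ (jc F θ hP g₀ os) (shellSplitOfRecord₁₃At N K₀ ρA ρB) F θ hP g₀ os) Rg) :=
  (s_N21_sRec₁₃CoPHOn_iff _ Rg).2 fun F θ hP hRg hθ g₀ os =>
    shellWeightBound_guarded₁₃CoPH_of_chartLaws K₀ jc ρA ρB Rg hread F θ hP hRg hθ g₀ os

end Guarded

/-! ## The `K₀ = 0` edition at K3⁷'s pin `crOfRecord₁₃V (jc F θ hP g₀ os) sh` -/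

section Pin

variable {N : ℕ} [NeZero N]
  (jc : (F : T4Family) → (θ : Stage13HParams F N) → θ.Provisos₁₃CoPH F N → (ℕ → ℝ) → List (ULoop F) → ℕ → ℕ)
  (ρA ρB : WidthLetter₁₃CoPH N) (Rg : (F : T4Family) → Stage13HParams F N → Prop)

/-- ★ **AT THE PIN `crOfRecord₁₃V`** (`K₀ = 0`, n20-d `crOfRecord₁₃V_eq = rfl`): for every `Rg`-guarded admissible tuple, `ShellWeightBound` at
`crOfRecord₁₃V (jc F θ hP g₀ os) (shellSplitOfRecord₁₃At N 0 ρA ρB) F θ hP g₀ os` — the `KeyedShellWeight`-conjunct shape of a `PinnedAtLive jc sh cr` witness of K3⁷ v4∕v5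
stub 2 on the guard `Rg`, with `sh := shellSplitOfRecord₁₃At N 0 ρA ρB` (dag-n21-d g9's split of record) and the chart road's per-tuple packages displayed. [bookkeeping] -/
theorem shellWeightBound_guarded₁₃CoPH_crOfRecord₁₃V_of_chartLaws
    (hread : ∀ (F : T4Family) (θ : Stage13HParams F N) (hP : θ.Provisos₁₃CoPH F N), Rg F θ → θ.Admissible F N →
      ∀ (g₀ : ℕ → ℝ) (os : List (ULoop F)),
      ∃ (E : B12.RunParams → ℝ) (DA DB : ℕ → ℝ),
        θ.ppSel = ppSelLiveOfRecord F N θ.ν θ.τ9 E (wOfRecord₉ F N θ.toStage9Params) ∧ ZetaMeasurable F N θ.ζ ∧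
        (∀ K, 0 ≤ ρA F θ hP g₀ os K) ∧ (∀ K, 0 ≤ DA K) ∧ (∀ K, 0 ≤ ρB F θ hP g₀ os K) ∧ (∀ K, 0 ≤ DB K) ∧
        Summable (fun K => DA K * ρA F θ hP g₀ os K) ∧ Summable (fun K => DB K * ρB F θ hP g₀ os K) ∧
        (∀ (K : ℕ) (t : ℝ), |t| ≤ 1 →
          ∀ (a : ↥(cubeIndices (F.P (0 + K)) (cubeSide (F.P (0 + K)).L θ.ν.M₂ (RkOfRecord (F.P (0 + K)).L θ.ν.r (histA₁₃ θ 0 g₀ K (0 + K))) (0 + K))))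
            (x : GaugeField (F.P (0 + K)) (0 + K) (SU N)),
            ∃ (S : ℝ) (c : GaugeField (F.P (0 + K)) (0 + K) (SU N)) (R : (↥(inputBlock F θ.ν (histA₁₃ θ 0 g₀ K) a) → SU N) → ℝ≥0∞)
              (U : BlockChartSU N (inputBlock F θ.ν (histA₁₃ θ 0 g₀ K) a) → ℝ) (A : Set (BlockChartSU N (inputBlock F θ.ν (histA₁₃ θ 0 g₀ K) a)))
              (f : BlockChartSU N (inputBlock F θ.ν (histA₁₃ θ 0 g₀ K) a) → ℝ≥0∞) (D : ℝ),
              0 ≤ S ∧ S ≤ Real.pi ∧ Measurable R ∧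
              blockFibreLawOfDatum₉ F N θ.toStage9Params (datumOfRecord₁₃CoPH F N θ hP) g₀ os (runA₁₃ F 0 g₀ K) (histA₁₃ θ 0 g₀ K) (0 + K) t a (inputBlock F θ.ν (histA₁₃ θ 0 g₀ K) a) x
                = (blockLaw (inputBlock F θ.ν (histA₁₃ θ 0 g₀ K) a)).withDensity (fun y => windowSU (inputBlock F θ.ν (histA₁₃ θ 0 g₀ K) a) c S y * R y) ∧
              MeasurableSet A ∧
              (∀ z ∈ closedBall (0 : BlockChartSU N (inputBlock F θ.ν (histA₁₃ θ 0 g₀ K) a)) S,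
                blockReading N (cubeStat F N θ.ν (histA₁₃ θ 0 g₀ K) (Kc := 0 + K) (k := 0 + K) a) (inputBlock F θ.ν (histA₁₃ θ 0 g₀ K) a) (fun _ => 1) (expFibreChartSU (inputBlock F θ.ν (histA₁₃ θ 0 g₀ K) a) c z) = U z) ∧
              ((fun z : BlockChartSU N (inputBlock F θ.ν (histA₁₃ θ 0 g₀ K) a) =>
                  chartWeightSU (inputBlock F θ.ν (histA₁₃ θ 0 g₀ K) a) S (expJacWeightSU (kappaSU N)) z * R (expFibreChartSU (inputBlock F θ.ν (histA₁₃ θ 0 g₀ K) a) c z))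
                =ᵐ[volume] A.indicator f) ∧
              SlotAntiConcentration (((volume : Measure (BlockChartSU N (inputBlock F θ.ν (histA₁₃ θ 0 g₀ K) a))).withDensity f).restrict A) U
                (epsOfRecord θ.ν (histA₁₃ θ 0 g₀ K) (0 + K)) (ρA F θ hP g₀ os K) D ∧
              D ≤ DA K) ∧
        (∀ (K : ℕ) (t : ℝ), |t| ≤ 1 →
          ∀ (a : ↥(cubeIndices (F.P (0 + K + 1)) (cubeSide (F.P (0 + K + 1)).L θ.ν.M₂ (RkOfRecord (F.P (0 + K + 1)).L θ.ν.r (histB₁₃ θ 0 g₀ K (0 + K + 1))) (0 + K + 1))))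
            (x : GaugeField (F.P (0 + K + 1)) (0 + K + 1) (SU N)),
            ∃ (S : ℝ) (c : GaugeField (F.P (0 + K + 1)) (0 + K + 1) (SU N)) (R : (↥(inputBlock F θ.ν (histB₁₃ θ 0 g₀ K) a) → SU N) → ℝ≥0∞)
              (U : BlockChartSU N (inputBlock F θ.ν (histB₁₃ θ 0 g₀ K) a) → ℝ) (A : Set (BlockChartSU N (inputBlock F θ.ν (histB₁₃ θ 0 g₀ K) a)))
              (f : BlockChartSU N (inputBlock F θ.ν (histB₁₃ θ 0 g₀ K) a) → ℝ≥0∞) (D : ℝ),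
              0 ≤ S ∧ S ≤ Real.pi ∧ Measurable R ∧
              blockFibreLawOfDatum₉ F N θ.toStage9Params (datumOfRecord₁₃CoPH F N θ hP) g₀ os (runB₁₃ F 0 g₀ K) (histB₁₃ θ 0 g₀ K) (0 + K + 1) t a (inputBlock F θ.ν (histB₁₃ θ 0 g₀ K) a) x
                = (blockLaw (inputBlock F θ.ν (histB₁₃ θ 0 g₀ K) a)).withDensity (fun y => windowSU (inputBlock F θ.ν (histB₁₃ θ 0 g₀ K) a) c S y * R y) ∧
              MeasurableSet A ∧
              (∀ z ∈ closedBall (0 : BlockChartSU N (inputBlock F θ.ν (histB₁₃ θ 0 g₀ K) a)) S,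
                blockReading N (cubeStat F N θ.ν (histB₁₃ θ 0 g₀ K) (Kc := 0 + K + 1) (k := 0 + K + 1) a) (inputBlock F θ.ν (histB₁₃ θ 0 g₀ K) a) (fun _ => 1) (expFibreChartSU (inputBlock F θ.ν (histB₁₃ θ 0 g₀ K) a) c z) = U z) ∧
              ((fun z : BlockChartSU N (inputBlock F θ.ν (histB₁₃ θ 0 g₀ K) a) =>
                  chartWeightSU (inputBlock F θ.ν (histB₁₃ θ 0 g₀ K) a) S (expJacWeightSU (kappaSU N)) z * R (expFibreChartSU (inputBlock F θ.ν (histB₁₃ θ 0 g₀ K) a) c z))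
                =ᵐ[volume] A.indicator f) ∧
              SlotAntiConcentration (((volume : Measure (BlockChartSU N (inputBlock F θ.ν (histB₁₃ θ 0 g₀ K) a))).withDensity f).restrict A) U
                (epsOfRecord θ.ν (histB₁₃ θ 0 g₀ K) (0 + K + 1)) (ρB F θ hP g₀ os K) D ∧
              D ≤ DB K))
    (F : T4Family) (θ : Stage13HParams F N) (hP : θ.Provisos₁₃CoPH F N) (hRg : Rg F θ) (hθ : θ.Admissible F N)
    (g₀ : ℕ → ℝ) (os : List (ULoop F)) :
    letI S := crOfRecord₁₃V (jc F θ hP g₀ os) (shellSplitOfRecord₁₃At N 0 ρA ρB) F θ hP g₀ os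
    ShellWeightBound S.l₀ S.T S.A S.B S.shA S.shB S.Wsh := by
  rw [crOfRecord₁₃V_eq]
  exact shellWeightBound_guarded₁₃CoPH_of_chartLaws 0 jc ρA ρB Rg hread F θ hP hRg hθ g₀ os

end Pin

end Summit.QuantumFields.YangMills.Theorems.N21ChartJunctionKeyed
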